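import Literature.NumberTheory.GaloisRepresentations.LocalDualityTheorem
import Literature.NumberTheory.GaloisRepresentations.ContinuousCupProductCompat
import HarnessLib

/-!
# The cup product of a PERFECT `μₙ`-valued pairing of finite modules over a local field is non-degenerate
# on both sides (theorems only; no definition, no named fact, no instance, no `sorry`)

Topic `NumberTheory/GaloisRepresentations` (companion of `LocalDualityTheorem` — local Tate duality
`localDuality_bijective` for a finite discrete `Γ_F`-module `A` and its dual `A^D = Hom(A, μₙ)`, Serre II §5.2 Thm. 2 /
Milne I Cor. 2.3, PROVED in the tree — and of `ContinuousCupProductCompat` (naturality of cup products)).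

Milne, *ADT* I Cor. 2.3 is stated for the EVALUATION pairing `A × A^D → μₙ`.  Consumers meet other perfect pairings:
Howard 2004, §1.3 H.4 / Lemma 3.1.1 / Def. 3.2.6 (arXiv:1202.6340 p. 7 L69–82, p. 15 L60–62, p. 16 L108–110) pairs
`Fil_v T` with `T/Fil_{v̄} T` (the plus part at `v` with the minus part at `v̄`, transported), a pairing of two DIFFERENT
local modules which is perfect because `Fil_v` is its own exact orthogonal complement under the Weil pairing.  This file
records the one-line reduction: for finite discrete `Γ_F`-modules `A` (killed by `n`) and `B` over a non-archimedean local
field `F` of characteristic `0` and a continuous equivariant pairing `P : A × B → μₙ(F̄)` which is PERFECT at the module level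
(`P(·, b) = 0 ⇒ b = 0`, and every additive `A → μₙ` is some `P(·, b)`):

* `ContPairing.exists_iso_homRep_of_perfect` — the adjoint `b ↦ P(·, b)` is an ISOMORPHISM of topological representations
  `B ≅ A^D` (equivariance from `P(ga, gb) = g P(a, b)`);
* `ContPairing.cupProduct_eq_evalPairing_cupProduct` — `x ∪_P y = x ∪_{ev} Θ_* y` (adjoint naturality of the cup product);
* **`ContPairing.eq_zero_of_forall_cupProduct_eq_zero_right`** — `(∀ x ∈ H¹(F, A), x ∪_P y = 0) ⇒ y = 0` in `H¹(F, B)`;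
* **`ContPairing.eq_zero_of_forall_cupProduct_eq_zero_left`** — `(∀ y ∈ H¹(F, B), x ∪_P y = 0) ⇒ x = 0` in `H¹(F, A)`;
both with values in `H²(F, μₙ)` (no invariant map needed: the injective `ι : H²(F, μₙ) → ℤ/n` of `localDuality_bijective` is
used internally and disappears from the statements).

Cell `pub/bsd-print-x9`, shared μ-item of rows 9/10 (STUB A, H.4 at `v ∣ p`, brick (B3) of `HOME/p1/H4-EXACT-AT-P-PLAN`: right
non-degeneracy of the RESTRICTED Weil–τ pairing `H¹(K_v, Fil_v W_j) × H¹(K_v, W′_j/Fil′) → H²`); seat `bsd-line-x10b-p1-w7` g2.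
No summit statement is proved; BSD is not proved by any of this.

References: [MilneADT2006] J. S. Milne, *Arithmetic Duality Theorems* (2006), I §0 (pairings, `M^D`), I Cor. 2.3;
[SerreGaloisCohomology1997] J.-P. Serre, *Galois Cohomology* (1997), II §5.2 Thm. 2; [NeukirchSchmidtWingberg2008] I §4 (1.4.2)
(naturality of cup products); [Howard2004HeegnerKolyvagin] B. Howard, Compositio Math. 140 (2004), §1.3 H.4, Lemma 3.1.1.
-/

noncomputable section

open CategoryTheory Function
open Field IsNonarchimedeanLocalField ValuativeRel

universe u

namespace Literature.NumberTheory.GaloisRepresentations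

open _root_.TopRep _root_.ContRepresentation _root_.ContinuousCohomology DiscreteGaloisModule

namespace ContPairing

section Adjoint

variable {G : Type u} [Group G] [TopologicalSpace G] [IsTopologicalGroup G]
variable {A B Ω : Type u} [AddCommGroup A] [TopologicalSpace A] [DiscreteTopology A] [Finite A]
  [AddCommGroup B] [TopologicalSpace B] [DiscreteTopology B]
  [AddCommGroup Ω] [TopologicalSpace Ω] [DiscreteTopology Ω]
  (ρA : ContinuousRep G ℤ A) (ρB : ContinuousRep G ℤ B) (ω : ContinuousRep G ℤ Ω)
  (P : ContPairing ρA.toTopRep ρB.toTopRep ω.toTopRep)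

/-- **A perfect equivariant pairing `P : A × B → Ω` identifies `B` with the dual `A^D = Hom(A, Ω)`** as topological
representations: the adjoint `b ↦ P(·, b)` is additive, equivariant (`P(ga, gb) = g P(a, b)`), injective (right kernel
trivial) and surjective (every additive `A → Ω` is represented), and all modules are discrete.
[cite: MilneADT2006, I §0 (pairings and the module M^D)] -/
theorem exists_iso_homRep_of_perfect
    (hinj : ∀ b : B, (∀ a : A, P.toLin a b = 0) → b = 0)
    (hsurj : ∀ f : A →+ Ω, ∃ b : B, ∀ a : A, P.toLin a b = f a) :
    ∃ e : ρB.toTopRep ≅ (ρA.homRep ω).toTopRep, ∀ (b : B) (a : A), e.hom.hom b a = P.toLin a b := by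
  let θ : B →+ HomCarrier A Ω :=
    { toFun := fun b ↦ HomCarrier.ofAddMonoidHom (P.toLin.flip b).toAddMonoidHom
      map_zero' := HomCarrier.ext fun a ↦ by simp
      map_add' := fun b b' ↦ HomCarrier.ext fun a ↦ by simp }
  have hθ : ∀ b a, θ b a = P.toLin a b := fun b a ↦ rfl
  have hθinj : Function.Injective θ := (injective_iff_map_eq_zero θ).2 fun b hb ↦
    hinj b fun a ↦ by rw [← hθ, hb, HomCarrier.zero_apply]
  have hθsurj : Function.Surjective θ := fun f ↦ by
    obtain ⟨b, hb⟩ := hsurj (f : A →+ Ω)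
    exact ⟨b, HomCarrier.ext fun a ↦ by rw [hθ, hb]; rfl⟩
  let eadd : B ≃+ HomCarrier A Ω := AddEquiv.ofBijective θ ⟨hθinj, hθsurj⟩
  let e : ρB.toTopRep ≃L[ℤ] (ρA.homRep ω).toTopRep :=
    { eadd.toIntLinearEquiv with
      continuous_toFun := continuous_of_discreteTopology
      continuous_invFun := continuous_of_discreteTopology }
  refine ⟨topRepIsoOfEquiv (X := ρB.toTopRep) (Y := (ρA.homRep ω).toTopRep) e fun g b ↦ ?_, fun b a ↦ rfl⟩
  refine HomCarrier.ext fun a ↦ ?_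
  change P.toLin a (ρB g b) = ω g (P.toLin (ρA g⁻¹ a) b)
  have h := P.toLin_smul g (ρA g⁻¹ a) b
  change P.toLin (ρA g (ρA g⁻¹ a)) (ρB g b) = ω g (P.toLin (ρA g⁻¹ a) b) at h
  rw [← Module.End.mul_apply, ← map_mul, mul_inv_cancel, map_one, Module.End.one_apply] at h
  exact h

variable [LocallyCompactSpace G]

/-- **`x ∪_P y = x ∪_{ev} Θ_* y`**: the cup product of `P` is the cup product of the evaluation pairing `A × A^D → Ω` after
the adjoint `Θ : B → A^D` on the second variable (adjoint naturality of the cup product).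
[cite: NeukirchSchmidtWingberg2008, I §4 (1.4.2)] [cite: MilneADT2006, I §0] -/
theorem cupProduct_eq_evalPairing_cupProduct (e : ρB.toTopRep ⟶ (ρA.homRep ω).toTopRep)
    (he : ∀ (b : B) (a : A), e.hom b a = P.toLin a b)
    (x : continuousCohomology 1 ρA.toTopRep) (y : continuousCohomology 1 ρB.toTopRep) :
    P.cupProduct x y = (ρA.evalPairing ω).cupProduct x (cohomologyMap e 1 y) := by
  have h := ContPairing.cupProduct_adjoint (ρA.evalPairing ω) P (𝟙 _) e (fun a b ↦ (he b a).symm) x y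
  have hx : cohomologyMap (𝟙 ρA.toTopRep) 1 x = x := by
    rw [show cohomologyMap (𝟙 ρA.toTopRep) 1 = 𝟙 _ from ContinuousCohomology.map_id _ _]; rfl
  rwa [hx] at h

end Adjoint

section Local

variable (F : Type u) [Field F] [ValuativeRel F] [TopologicalSpace F] [IsNonarchimedeanLocalField F]
  [CharZero F]
variable {A B : Type u} [AddCommGroup A] [TopologicalSpace A] [DiscreteTopology A] [Finite A]
  [AddCommGroup B] [TopologicalSpace B] [DiscreteTopology B]
  (ρA : ContinuousRep (absoluteGaloisGroup F) ℤ A) (ρB : ContinuousRep (absoluteGaloisGroup F) ℤ B)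
  {n : ℕ} [NeZero n]
  (P : ContPairing ρA.toTopRep ρB.toTopRep (mu F n).toTopRep)

/-- **Right non-degeneracy of the cup product of a perfect pairing over a local field.**  For `A` finite killed by `n`,
`B` discrete and `P : A × B → μₙ(F̄)` continuous, equivariant and PERFECT at the module level (right kernel trivial, every
additive `A → μₙ` represented by an element of `B`), a class `y ∈ H¹(F, B)` with `x ∪_P y = 0` in `H²(F, μₙ)` for every
`x ∈ H¹(F, A)` is zero: `Θ : B ≅ A^D`, `x ∪_P y = x ∪_{ev} Θ_* y`, and local Tate duality (`localDuality_bijective`) makes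
`y' ↦ ι(· ∪_{ev} y')` injective on `H¹(F, A^D)`. [cite: MilneADT2006, I Cor. 2.3] [cite: SerreGaloisCohomology1997, II §5.2 Thm. 2]
[cite: Howard2004HeegnerKolyvagin, §1.3 H.4 and Lemma 3.1.1 (arXiv p. 7 L78–82, p. 15 L60–62: the perfect pairing of Fil_v with T/Fil_v̄)] -/
theorem eq_zero_of_forall_cupProduct_eq_zero_right (hA : ∀ a : A, n • a = 0)
    (hinj : ∀ b : B, (∀ a : A, P.toLin a b = 0) → b = 0)
    (hsurj : ∀ f : A →+ MuCarrier F n, ∃ b : B, ∀ a : A, P.toLin a b = f a)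
    (y : continuousCohomology 1 ρB.toTopRep)
    (hy : ∀ x : continuousCohomology 1 ρA.toTopRep, P.cupProduct x y = 0) : y = 0 := by
  obtain ⟨e, he⟩ := exists_iso_homRep_of_perfect ρA ρB (mu F n) P hinj hsurj
  obtain ⟨ι, -, -, hbf⟩ := localDuality_bijective F ρA hA
  have key : ∀ x, P.cupProduct x y = (ρA.evalPairing (mu F n)).cupProduct x (cohomologyMap e.hom 1 y) :=
    fun x ↦ cupProduct_eq_evalPairing_cupProduct ρA ρB (mu F n) P e.hom he x y
  have h1 : (ρA.dualityPairing (mu F n) ι).flip (cohomologyMap e.hom 1 y) = 0 := by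
    refine AddMonoidHom.ext fun x ↦ ?_
    rw [AddMonoidHom.flip_apply, ContinuousRep.dualityPairing_apply, ← key, hy, map_zero, AddMonoidHom.zero_apply]
  have h2 : cohomologyMap e.hom 1 y = 0 := hbf.1 (by rw [h1, map_zero])
  apply (continuousCohomologyEquivOfIso e 1).injective
  change cohomologyMap e.hom 1 y = cohomologyMap e.hom 1 0
  rw [h2, map_zero]

/-- **Left non-degeneracy of the cup product of a perfect pairing over a local field**: under the same hypotheses, a class
`x ∈ H¹(F, A)` with `x ∪_P y = 0` for every `y ∈ H¹(F, B)` is zero (`Θ_*` is onto `H¹(F, A^D)` and `x' ↦ ι(x' ∪_{ev} ·)` is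
injective on `H¹(F, A)`). [cite: MilneADT2006, I Cor. 2.3] [cite: SerreGaloisCohomology1997, II §5.2 Thm. 2]
[cite: Howard2004HeegnerKolyvagin, §1.3 H.4 and Lemma 3.1.1 (arXiv p. 7 L78–82, p. 15 L60–62)] -/
theorem eq_zero_of_forall_cupProduct_eq_zero_left (hA : ∀ a : A, n • a = 0)
    (hinj : ∀ b : B, (∀ a : A, P.toLin a b = 0) → b = 0)
    (hsurj : ∀ f : A →+ MuCarrier F n, ∃ b : B, ∀ a : A, P.toLin a b = f a)
    (x : continuousCohomology 1 ρA.toTopRep)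
    (hx : ∀ y : continuousCohomology 1 ρB.toTopRep, P.cupProduct x y = 0) : x = 0 := by
  obtain ⟨e, he⟩ := exists_iso_homRep_of_perfect ρA ρB (mu F n) P hinj hsurj
  obtain ⟨ι, -, hb, -⟩ := localDuality_bijective F ρA hA
  have key : ∀ y, P.cupProduct x y = (ρA.evalPairing (mu F n)).cupProduct x (cohomologyMap e.hom 1 y) :=
    fun y ↦ cupProduct_eq_evalPairing_cupProduct ρA ρB (mu F n) P e.hom he x y
  have h1 : ρA.dualityPairing (mu F n) ι x = 0 := by
    refine AddMonoidHom.ext fun y' ↦ ?_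
    obtain ⟨y, rfl⟩ := (continuousCohomologyEquivOfIso e 1).surjective y'
    change ρA.dualityPairing (mu F n) ι x (cohomologyMap e.hom 1 y) = 0
    rw [ContinuousRep.dualityPairing_apply, ← key, hx, map_zero]
  exact hb.1 (by rw [h1, map_zero])

/-- **Both kernels trivial, packaged** (the hypothesis shapes (Nondeg)/(Nondeg′) of the tree's H.4 descent
`Tower.pow_smul_eq_zero_of_forall_pairing_eq_zero` / `mem_levelCondition_top_of_forall_pairing_bot_eq_zero_of_range` for
the cup-product pairing of `P`). [cite: MilneADT2006, I Cor. 2.3] [cite: Howard2004HeegnerKolyvagin, §1.3 H.4 and Def. 3.2.6] -/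
theorem cupProduct_nondegenerate (hA : ∀ a : A, n • a = 0)
    (hinj : ∀ b : B, (∀ a : A, P.toLin a b = 0) → b = 0)
    (hsurj : ∀ f : A →+ MuCarrier F n, ∃ b : B, ∀ a : A, P.toLin a b = f a) :
    (∀ x : continuousCohomology 1 ρA.toTopRep,
        (∀ y : continuousCohomology 1 ρB.toTopRep, P.cupProduct x y = 0) → x = 0) ∧
      ∀ y : continuousCohomology 1 ρB.toTopRep,
        (∀ x : continuousCohomology 1 ρA.toTopRep, P.cupProduct x y = 0) → y = 0 :=
  ⟨fun x hx ↦ eq_zero_of_forall_cupProduct_eq_zero_left F ρA ρB P hA hinj hsurj x hx,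
    fun y hy ↦ eq_zero_of_forall_cupProduct_eq_zero_right F ρA ρB P hA hinj hsurj y hy⟩

end Local

end ContPairing

end Literature.NumberTheory.GaloisRepresentations

end
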